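import Mathlib
import HarnessLib
import Summits.Ventures.LatticeQCDFlow.Exactness.EnergyViolationSecondOrder
import Summits.Ventures.LatticeQCDFlow.Exactness.CreutzEstimatorVariance
import Summits.Ventures.LatticeQCDFlow.Exactness.Omf2ProposalLaws

/-!
# The `dH`-column laws for the engine's OMF2 proposal: `⟨ΔH⟩ = ½⟨ΔH²⟩ + third order` and `Var e^{−ΔH} = ⟨e^{ΔH}⟩ − 1`, both rungs, every pair of forces

HONEST FRAMING: exact (Metropolis-corrected) sampling algorithms for lattice gauge theory;
figures of merit are autocorrelation/cost numbers at stated couplings and volumes; no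
continuum-physics claim.

Venture `LatticeQCDFlow` (cell pub-lqcd), topic `Exactness`; FANOUT row 14 (`eng-flowhmc`, integrator
`omf2`).  NEW WORK of the cell; nothing cited as a fact.  Corollary file: the abstract laws of
`EnergyViolationSecondOrder.lean` (`abs_integral_deltaH_sub_half_sq_le`) and `CreutzEstimatorVariance.lean`
(`integral_sq_exp_neg_deltaH_sub_one`) need exactly a measurable measure-preserving involution;
`Omf2ProposalLaws.lean` supplies those three facts for `Ψ = flip ∘ (omf2Word g₁ D g₂)ⁿ` with the Pauli drift
on `SU(2)` and the `U(1)` drift.  Hence, for EVERY Hamiltonian `H` on phase space with `e^{−H}` integrable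
over `Haar^{⊗ι} ⊗ Lebesgue`, EVERY pair of measurable forces, every `δ`, `n`:

* `su2Omf2ProposalN_deltaH_second_order` / `u1Omf2ProposalN_deltaH_second_order` — given the three moments,
  `|∫ ΔH e^{−H} − ½ ∫ ΔH² e^{−H}| ≤ (1/6) ∫ |ΔH|³ e^{|ΔH|} e^{−H}`;
* `su2Omf2ProposalN_creutz_variance` / `u1Omf2ProposalN_creutz_variance` — given `e^{ΔH} e^{−H}` integrable,
  `∫ (e^{−ΔH} − 1)² e^{−H} = ∫ e^{ΔH} e^{−H} − ∫ e^{−H}`.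

NOT CLAIMED: finiteness of the moments for Gaussian momenta; floating point.
-/

noncomputable section

namespace Summit.Ventures.LatticeQCDFlow.Exactness

open Set Function MeasureTheory Filter
open Literature.MathematicalPhysics.QuantumFieldTheory

set_option backward.isDefEq.respectTransparency false

/-! ## §1 The `SU(2)` rung -/

section SU2

variable {ι : Type*} [Fintype ι] {g₁ g₂ : (ι → Matrix.specialUnitaryGroup (Fin 2) ℂ) → ι → EuclideanSpace ℝ (Fin 3)}

/-- **`⟨ΔH⟩ = ½⟨ΔH²⟩ + third order` for the OMF2 proposal on `SU(2)`**, every `H` with `e^{−H}` integrable,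
every pair of measurable forces (given the three moments). -/
theorem su2Omf2ProposalN_deltaH_second_order (hg₁ : Measurable g₁) (hg₂ : Measurable g₂) (δ : ℝ) (n : ℕ)
    {H : (ι → Matrix.specialUnitaryGroup (Fin 2) ℂ) × (ι → EuclideanSpace ℝ (Fin 3)) → ℝ}
    (h0 : Integrable (fun z => Real.exp (-H z))
      ((Measure.pi fun _ : ι => haarProbability (Matrix.specialUnitaryGroup (Fin 2) ℂ)).prod
        (volume : Measure (ι → EuclideanSpace ℝ (Fin 3)))))
    (h1 : Integrable (fun z => deltaH H (⇑((flip : Equiv.Perm ((ι → Matrix.specialUnitaryGroup (Fin 2) ℂ) ×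
        (ι → EuclideanSpace ℝ (Fin 3)))) * omf2Word g₁ (mulDrift (su2ExpDrift δ)) g₂ ^ n)) z * Real.exp (-H z))
      ((Measure.pi fun _ : ι => haarProbability (Matrix.specialUnitaryGroup (Fin 2) ℂ)).prod
        (volume : Measure (ι → EuclideanSpace ℝ (Fin 3)))))
    (h2 : Integrable (fun z => deltaH H (⇑((flip : Equiv.Perm ((ι → Matrix.specialUnitaryGroup (Fin 2) ℂ) ×
        (ι → EuclideanSpace ℝ (Fin 3)))) * omf2Word g₁ (mulDrift (su2ExpDrift δ)) g₂ ^ n)) z ^ 2 * Real.exp (-H z))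
      ((Measure.pi fun _ : ι => haarProbability (Matrix.specialUnitaryGroup (Fin 2) ℂ)).prod
        (volume : Measure (ι → EuclideanSpace ℝ (Fin 3)))))
    (h3 : Integrable (fun z => |deltaH H (⇑((flip : Equiv.Perm ((ι → Matrix.specialUnitaryGroup (Fin 2) ℂ) ×
        (ι → EuclideanSpace ℝ (Fin 3)))) * omf2Word g₁ (mulDrift (su2ExpDrift δ)) g₂ ^ n)) z| ^ 3 *
        Real.exp |deltaH H (⇑((flip : Equiv.Perm ((ι → Matrix.specialUnitaryGroup (Fin 2) ℂ) ×
          (ι → EuclideanSpace ℝ (Fin 3)))) * omf2Word g₁ (mulDrift (su2ExpDrift δ)) g₂ ^ n)) z| * Real.exp (-H z))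
      ((Measure.pi fun _ : ι => haarProbability (Matrix.specialUnitaryGroup (Fin 2) ℂ)).prod
        (volume : Measure (ι → EuclideanSpace ℝ (Fin 3))))) :
    |∫ z, deltaH H (⇑((flip : Equiv.Perm ((ι → Matrix.specialUnitaryGroup (Fin 2) ℂ) ×
          (ι → EuclideanSpace ℝ (Fin 3)))) * omf2Word g₁ (mulDrift (su2ExpDrift δ)) g₂ ^ n)) z * Real.exp (-H z)
        ∂((Measure.pi fun _ : ι => haarProbability (Matrix.specialUnitaryGroup (Fin 2) ℂ)).prod
          (volume : Measure (ι → EuclideanSpace ℝ (Fin 3))))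
      - 1 / 2 * ∫ z, deltaH H (⇑((flip : Equiv.Perm ((ι → Matrix.specialUnitaryGroup (Fin 2) ℂ) ×
          (ι → EuclideanSpace ℝ (Fin 3)))) * omf2Word g₁ (mulDrift (su2ExpDrift δ)) g₂ ^ n)) z ^ 2 * Real.exp (-H z)
        ∂((Measure.pi fun _ : ι => haarProbability (Matrix.specialUnitaryGroup (Fin 2) ℂ)).prod
          (volume : Measure (ι → EuclideanSpace ℝ (Fin 3))))|
      ≤ 1 / 6 * ∫ z, |deltaH H (⇑((flip : Equiv.Perm ((ι → Matrix.specialUnitaryGroup (Fin 2) ℂ) ×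
          (ι → EuclideanSpace ℝ (Fin 3)))) * omf2Word g₁ (mulDrift (su2ExpDrift δ)) g₂ ^ n)) z| ^ 3 *
          Real.exp |deltaH H (⇑((flip : Equiv.Perm ((ι → Matrix.specialUnitaryGroup (Fin 2) ℂ) ×
            (ι → EuclideanSpace ℝ (Fin 3)))) * omf2Word g₁ (mulDrift (su2ExpDrift δ)) g₂ ^ n)) z| * Real.exp (-H z)
        ∂((Measure.pi fun _ : ι => haarProbability (Matrix.specialUnitaryGroup (Fin 2) ℂ)).prod
          (volume : Measure (ι → EuclideanSpace ℝ (Fin 3)))) :=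
  abs_integral_deltaH_sub_half_sq_le
    (μ := (Measure.pi fun _ : ι => haarProbability (Matrix.specialUnitaryGroup (Fin 2) ℂ)).prod
      (volume : Measure (ι → EuclideanSpace ℝ (Fin 3)))) (H := H)
    (Ψ := ⇑((flip : Equiv.Perm ((ι → Matrix.specialUnitaryGroup (Fin 2) ℂ) × (ι → EuclideanSpace ℝ (Fin 3)))) *
      omf2Word g₁ (mulDrift (su2ExpDrift δ)) g₂ ^ n))
    (measurable_su2Omf2ProposalN δ n hg₁ hg₂) (involutive_su2Omf2ProposalN g₁ g₂ δ n)
    (measurePreserving_su2Omf2ProposalN δ n hg₁ hg₂) h0 h1 h2 h3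

/-- **`Var e^{−ΔH} = ⟨e^{ΔH}⟩ − 1` for the OMF2 proposal on `SU(2)`** (un-normalised): every `H` with `e^{−H}`
and `e^{ΔH} e^{−H}` integrable, every pair of measurable forces. -/
theorem su2Omf2ProposalN_creutz_variance (hg₁ : Measurable g₁) (hg₂ : Measurable g₂) (δ : ℝ) (n : ℕ)
    {H : (ι → Matrix.specialUnitaryGroup (Fin 2) ℂ) × (ι → EuclideanSpace ℝ (Fin 3)) → ℝ}
    (h0 : Integrable (fun z => Real.exp (-H z))
      ((Measure.pi fun _ : ι => haarProbability (Matrix.specialUnitaryGroup (Fin 2) ℂ)).prod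
        (volume : Measure (ι → EuclideanSpace ℝ (Fin 3)))))
    (hP : Integrable (fun z => Real.exp (deltaH H (⇑((flip : Equiv.Perm ((ι → Matrix.specialUnitaryGroup (Fin 2) ℂ) ×
        (ι → EuclideanSpace ℝ (Fin 3)))) * omf2Word g₁ (mulDrift (su2ExpDrift δ)) g₂ ^ n)) z) * Real.exp (-H z))
      ((Measure.pi fun _ : ι => haarProbability (Matrix.specialUnitaryGroup (Fin 2) ℂ)).prod
        (volume : Measure (ι → EuclideanSpace ℝ (Fin 3))))) :
    ∫ z, (Real.exp (-deltaH H (⇑((flip : Equiv.Perm ((ι → Matrix.specialUnitaryGroup (Fin 2) ℂ) ×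
          (ι → EuclideanSpace ℝ (Fin 3)))) * omf2Word g₁ (mulDrift (su2ExpDrift δ)) g₂ ^ n)) z) - 1) ^ 2 * Real.exp (-H z)
        ∂((Measure.pi fun _ : ι => haarProbability (Matrix.specialUnitaryGroup (Fin 2) ℂ)).prod
          (volume : Measure (ι → EuclideanSpace ℝ (Fin 3))))
      = ∫ z, Real.exp (deltaH H (⇑((flip : Equiv.Perm ((ι → Matrix.specialUnitaryGroup (Fin 2) ℂ) ×
            (ι → EuclideanSpace ℝ (Fin 3)))) * omf2Word g₁ (mulDrift (su2ExpDrift δ)) g₂ ^ n)) z) * Real.exp (-H z)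
          ∂((Measure.pi fun _ : ι => haarProbability (Matrix.specialUnitaryGroup (Fin 2) ℂ)).prod
            (volume : Measure (ι → EuclideanSpace ℝ (Fin 3))))
        - ∫ z, Real.exp (-H z)
          ∂((Measure.pi fun _ : ι => haarProbability (Matrix.specialUnitaryGroup (Fin 2) ℂ)).prod
            (volume : Measure (ι → EuclideanSpace ℝ (Fin 3)))) :=
  integral_sq_exp_neg_deltaH_sub_one
    (μ := (Measure.pi fun _ : ι => haarProbability (Matrix.specialUnitaryGroup (Fin 2) ℂ)).prod
      (volume : Measure (ι → EuclideanSpace ℝ (Fin 3)))) (H := H)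
    (Ψ := ⇑((flip : Equiv.Perm ((ι → Matrix.specialUnitaryGroup (Fin 2) ℂ) × (ι → EuclideanSpace ℝ (Fin 3)))) *
      omf2Word g₁ (mulDrift (su2ExpDrift δ)) g₂ ^ n))
    (measurable_su2Omf2ProposalN δ n hg₁ hg₂) (involutive_su2Omf2ProposalN g₁ g₂ δ n)
    (measurePreserving_su2Omf2ProposalN δ n hg₁ hg₂) h0 hP

end SU2

/-! ## §2 The `U(1)` rung -/

section U1

variable {ι : Type*} [Fintype ι] {g₁ g₂ : (ι → Circle) → ι → ℝ}

/-- **`⟨ΔH⟩ = ½⟨ΔH²⟩ + third order` for the OMF2 proposal on `U(1)`** (given the three moments). -/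
theorem u1Omf2ProposalN_deltaH_second_order (hg₁ : Measurable g₁) (hg₂ : Measurable g₂) (δ : ℝ) (n : ℕ)
    {H : (ι → Circle) × (ι → ℝ) → ℝ}
    (h0 : Integrable (fun z => Real.exp (-H z))
      ((Measure.pi fun _ : ι => haarProbability Circle).prod (volume : Measure (ι → ℝ))))
    (h1 : Integrable (fun z => deltaH H (⇑((flip : Equiv.Perm ((ι → Circle) × (ι → ℝ))) *
        omf2Word g₁ (mulDrift (u1ExpDrift δ)) g₂ ^ n)) z * Real.exp (-H z))
      ((Measure.pi fun _ : ι => haarProbability Circle).prod (volume : Measure (ι → ℝ))))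
    (h2 : Integrable (fun z => deltaH H (⇑((flip : Equiv.Perm ((ι → Circle) × (ι → ℝ))) *
        omf2Word g₁ (mulDrift (u1ExpDrift δ)) g₂ ^ n)) z ^ 2 * Real.exp (-H z))
      ((Measure.pi fun _ : ι => haarProbability Circle).prod (volume : Measure (ι → ℝ))))
    (h3 : Integrable (fun z => |deltaH H (⇑((flip : Equiv.Perm ((ι → Circle) × (ι → ℝ))) *
        omf2Word g₁ (mulDrift (u1ExpDrift δ)) g₂ ^ n)) z| ^ 3 *
        Real.exp |deltaH H (⇑((flip : Equiv.Perm ((ι → Circle) × (ι → ℝ))) *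
          omf2Word g₁ (mulDrift (u1ExpDrift δ)) g₂ ^ n)) z| * Real.exp (-H z))
      ((Measure.pi fun _ : ι => haarProbability Circle).prod (volume : Measure (ι → ℝ)))) :
    |∫ z, deltaH H (⇑((flip : Equiv.Perm ((ι → Circle) × (ι → ℝ))) *
          omf2Word g₁ (mulDrift (u1ExpDrift δ)) g₂ ^ n)) z * Real.exp (-H z)
        ∂((Measure.pi fun _ : ι => haarProbability Circle).prod (volume : Measure (ι → ℝ)))
      - 1 / 2 * ∫ z, deltaH H (⇑((flip : Equiv.Perm ((ι → Circle) × (ι → ℝ))) *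
          omf2Word g₁ (mulDrift (u1ExpDrift δ)) g₂ ^ n)) z ^ 2 * Real.exp (-H z)
        ∂((Measure.pi fun _ : ι => haarProbability Circle).prod (volume : Measure (ι → ℝ)))|
      ≤ 1 / 6 * ∫ z, |deltaH H (⇑((flip : Equiv.Perm ((ι → Circle) × (ι → ℝ))) *
          omf2Word g₁ (mulDrift (u1ExpDrift δ)) g₂ ^ n)) z| ^ 3 *
          Real.exp |deltaH H (⇑((flip : Equiv.Perm ((ι → Circle) × (ι → ℝ))) *
            omf2Word g₁ (mulDrift (u1ExpDrift δ)) g₂ ^ n)) z| * Real.exp (-H z)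
        ∂((Measure.pi fun _ : ι => haarProbability Circle).prod (volume : Measure (ι → ℝ))) :=
  abs_integral_deltaH_sub_half_sq_le
    (μ := (Measure.pi fun _ : ι => haarProbability Circle).prod (volume : Measure (ι → ℝ))) (H := H)
    (Ψ := ⇑((flip : Equiv.Perm ((ι → Circle) × (ι → ℝ))) * omf2Word g₁ (mulDrift (u1ExpDrift δ)) g₂ ^ n))
    (measurable_u1Omf2ProposalN δ n hg₁ hg₂) (involutive_u1Omf2ProposalN g₁ g₂ δ n)
    (measurePreserving_u1Omf2ProposalN δ n hg₁ hg₂) h0 h1 h2 h3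

/-- **`Var e^{−ΔH} = ⟨e^{ΔH}⟩ − 1` for the OMF2 proposal on `U(1)`** (un-normalised). -/
theorem u1Omf2ProposalN_creutz_variance (hg₁ : Measurable g₁) (hg₂ : Measurable g₂) (δ : ℝ) (n : ℕ)
    {H : (ι → Circle) × (ι → ℝ) → ℝ}
    (h0 : Integrable (fun z => Real.exp (-H z))
      ((Measure.pi fun _ : ι => haarProbability Circle).prod (volume : Measure (ι → ℝ))))
    (hP : Integrable (fun z => Real.exp (deltaH H (⇑((flip : Equiv.Perm ((ι → Circle) × (ι → ℝ))) *
        omf2Word g₁ (mulDrift (u1ExpDrift δ)) g₂ ^ n)) z) * Real.exp (-H z))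
      ((Measure.pi fun _ : ι => haarProbability Circle).prod (volume : Measure (ι → ℝ)))) :
    ∫ z, (Real.exp (-deltaH H (⇑((flip : Equiv.Perm ((ι → Circle) × (ι → ℝ))) *
          omf2Word g₁ (mulDrift (u1ExpDrift δ)) g₂ ^ n)) z) - 1) ^ 2 * Real.exp (-H z)
        ∂((Measure.pi fun _ : ι => haarProbability Circle).prod (volume : Measure (ι → ℝ)))
      = ∫ z, Real.exp (deltaH H (⇑((flip : Equiv.Perm ((ι → Circle) × (ι → ℝ))) *
            omf2Word g₁ (mulDrift (u1ExpDrift δ)) g₂ ^ n)) z) * Real.exp (-H z)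
          ∂((Measure.pi fun _ : ι => haarProbability Circle).prod (volume : Measure (ι → ℝ)))
        - ∫ z, Real.exp (-H z) ∂((Measure.pi fun _ : ι => haarProbability Circle).prod (volume : Measure (ι → ℝ))) :=
  integral_sq_exp_neg_deltaH_sub_one
    (μ := (Measure.pi fun _ : ι => haarProbability Circle).prod (volume : Measure (ι → ℝ))) (H := H)
    (Ψ := ⇑((flip : Equiv.Perm ((ι → Circle) × (ι → ℝ))) * omf2Word g₁ (mulDrift (u1ExpDrift δ)) g₂ ^ n))
    (measurable_u1Omf2ProposalN δ n hg₁ hg₂) (involutive_u1Omf2ProposalN g₁ g₂ δ n)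
    (measurePreserving_u1Omf2ProposalN δ n hg₁ hg₂) h0 hP

end U1

end Summit.Ventures.LatticeQCDFlow.Exactness
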